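import Summits.HodgeConjecture.HodgeConjecture.Theorems.Ring2AbelianAllAndreDiscriminantTransport
import Literature.AlgebraicGeometry.HodgeTheory.AbelianVarietyEndomorphismsHOne
import Literature.AlgebraicGeometry.HodgeTheory.WeilClasses
import Literature.AlgebraicGeometry.Motives.AbelianVarietyCohomologyExteriorH1
import HarnessLib

/-!
# Ring 2 · sub-cell AbelianAll (ALL ABELIAN VARIETIES), André axis, part L-e — THE WEIL LINES ARE FLAT FOR THE `K`-ACTION ALONE: with a global
# endomorphism `Φ` of the pencil over the base (no `ℤ[φ]`-action, no group law needed), a global class whose restriction to ONE member is an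
# `E₊`- (resp. `E₋`-, resp. any `χ`-eigen-) class of the charted abelian variety restricts to such a class on EVERY member — transport in
# `R^k f_* ℂ` is multiplicative, `H^k` of an abelian variety is spanned by cup products of `H¹`, and `(x·𝟙 + y·φ)^* = x + y φ^*` on `H¹`

HONEST FRAMING (page 1, verbatim): **research route, not a corollary; conditional on HC_CM plus one named
minimal statement.** Cell line: research route conditional on HC_CM; not a corollary; Q11.4-sentence-2
already refuted in dim ≥ 3. Nothing in this file proves a case of the Hodge conjecture or of `B(X)` for a named `X`; nothing is Hodge-theoretic.
`HC_CM`, `HC_AV`, the global nodes, Verdier's binder: ABSENT. Item `Theses.RankFourFaces.CMToAbelian` (stmt-16267) stays OPEN; N104 untouched; no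
node is born (0 `def`, 0 `sorry`, no named fact). Seat `pub-hodge-ring2-ab-andre-2`, gen 42 (part L; item (o153)). Part XLVIII-d
(`…TwistedProductHabitat`) proved the same flatness from a global `ℤ[φ]`-ACTION `Ψ_{x,y} = x·𝟙 + y·Φ` on the pencil with charted fibre maps for all
`x, y`; here ONE global endomorphism `Φ` suffices, because the test endomorphisms `x·𝟙 + y·φ_s` of the members need not extend to the total space:
their action on `H^•(A_s)` is determined by `φ_s^*|_{H¹}` (`H^•` of an abelian variety is generated by `H¹`).

## Content (theorems only; standard axioms)

* §1 **`mem_pullbackEigenclasses_of_transport`** — for `π : 𝒳 ⟶ S` cohomologically locally trivial over `U`, an endomorphism `Φ` OVER `S` with fibre maps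
  `Φ_u`, charts `e_A : A ≅ X_t`, `e_B : B ≅ X_s` by abelian varieties with endomorphisms `φ`, `ψ` matching `Φ_t`, `Φ_s`, a homotopy class of paths `γ`
  from `t` to `s`, and ANY character `χ : ℕ → ℕ → ℂ`: if `e_A^*(W|X_t)` lies in the `χ`-eigenclass space of `(A, φ)` in degree `k` (i.e.
  `(x·𝟙 + y·φ)^* c = χ(x,y)·c` for all `x, y`), then `e_B^*(W|X_s)` lies in that of `(B, ψ)` — for EVERY global class `W ∈ H^k(𝒳(ℂ); ℂ)`. Proof: the
  conjugated transport `T = e_B^* ∘ γ_* ∘ (e_A⁻¹)^*` fixes the restrictions of `W`, intertwines `(x·𝟙 + y·φ)^*` with `(x·𝟙 + y·ψ)^*` on `H¹`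
  (`(x·𝟙 + y·φ)^* = x + y φ^*` there, `complexBetti_map_nsmul_id_add_nsmul_one`; `T φ^* = ψ^* T` by `transportFun_map_fiberHom`), and both `T` and the
  pull-backs are multiplicative on the iterated cup products `v₁ ⌣ ⋯ ⌣ v_k` of degree-one classes, which SPAN `H^k(A(ℂ); ℂ)`
  (`AbelianVariety.hasExteriorCohomologyH1_complexPoints`). **`mem_weilClassesPlus_of_transport`**, **`mem_weilClassesMinus_of_transport`** — the
  Weil lines `E₊ = ⋀^{2n}V₊`, `E₋ = ⋀^{2n}V₋` (characters `(x ± iy√d)^{2n}`).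
* §2 (compact abelian pencils, any two members; Ehresmann + path-connectedness) **`map_chart_fiberι_mem_weilClassesPlus_member_of_member`**,
  **`map_chart_fiberι_mem_weilClassesMinus_member_of_member`** — the hypotheses `hUp : ∀ s, e_s^*(U₊|X_s) ∈ E₊(A_s, φ_s)` and `hUm` of the `B⋆` rows
  (parts XLVIII-c … L-d) follow from the SAME at the one charted member `t`, given the `K`-action `Φ` with `K`-compatible charts.

## Honest status

Bookkeeping (item (o153)): with parts L-a (discriminant), L-c (rank data), L-d (Weil type) and this file (Weil lines), EVERY per-member hypothesis of the
twisted-product rows that is constant in print along a Weil-type pencil is a theorem of the carriers from the datum at ONE member plus the `K`-action;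
what the rows still display member-by-member is structure only (the charts `e_s`, `φ_s`, the twisted endomorphisms `Φ_s = φ_s × (−φ_t)`, algebraicity of
`θⁿ` on every member). Strength of the open instance unchanged; nothing minimal is claimed; N104 untouched. EDGE LABELS: §1–§2 K (fact-free).
References: Deligne1982HodgeCycles (§4 Prop. 4.4 and proof of Thm. 4.8, pp. 56–61: the `E`-action on `Y/S`, `⋀ V₊ ⊕ ⋀ V₋` flat); vanGeemen1994HodgeAV
(4.8–4.9, Lemma 5.2 (6)); VoisinHodgeII2003 (§3.1.2); LangeBirkenhake1992 (§1.1 p. 19, `ρ_r` additive); MumfordAV1970 (§1 (4), `H^• = ⋀ H¹`).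
-/

noncomputable section

set_option linter.dupNamespace false

namespace Summit.HodgeConjecture.HodgeConjecture.Ring2.AbelianAll

open CategoryTheory AlgebraicGeometry
open _root_.Topology _root_.Filter
open Literature.AlgebraicGeometry Literature.AlgebraicGeometry.Motives
open Literature.AlgebraicGeometry.HodgeTheory
open Literature.AlgebraicTopology.SingularHomology (singularCohomology cupProduct cupPowOne map_cupPowOne)

/-! ## §1 Along a path: `χ`-eigenclasses of the charted members correspond -/

section Transport

variable {𝒳 S : SchemeOver ℂ} (π : 𝒳 ⟶ S) {U : Set (ComplexPoints S)}

/-- **The `χ`-eigenclass spaces are flat for the `K`-action.** Let `π : 𝒳 ⟶ S` be cohomologically locally trivial over `U`, `Φ` an endomorphism of `𝒳`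
OVER `S` with fibre maps `Φ_u` (`Φ_u ≫ ι_u = ι_u ≫ Φ`), `γ` a homotopy class of paths from `t` to `s` in `U`, and `e_A : A ≅ X_t`, `e_B : B ≅ X_s` charts by
abelian varieties with endomorphisms `φ`, `ψ` matching `Φ_t`, `Φ_s`. For every global class `W ∈ H^k(𝒳(ℂ); ℂ)` and every character `χ`:
if `(x·𝟙_A + y·φ)^* (e_A^*(W|X_t)) = χ(x, y) · e_A^*(W|X_t)` for all `x y : ℕ`, then `(x·𝟙_B + y·ψ)^* (e_B^*(W|X_s)) = χ(x, y) · e_B^*(W|X_s)` for all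
`x y`. The conjugated transport `T = e_B^* γ_* (e_A⁻¹)^*` is linear, multiplicative on `v₁ ⌣ ⋯ ⌣ v_k` (`transportFun_cupPowOne`, `map_cupPowOne`),
intertwines the test pull-backs on `H¹` (they are `x + yφ^*` there, and `T φ^* = ψ^* T`), hence on `H^k = ⋀^k H¹` (spanned by the `v₁ ⌣ ⋯ ⌣ v_k`), and
fixes the restrictions of `W` (`transportFun_map_fiberι`). [cite: Deligne1982HodgeCycles, §4 proof of Thm. 4.8 (pp. 56–61)]
[cite: vanGeemen1994HodgeAV, 4.8–4.9] [cite: VoisinHodgeII2003, §3.1.2] -/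
theorem mem_pullbackEigenclasses_of_transport (hU : IsCohomologicallyLocallyTrivialOn π U) (Φ : 𝒳 ⟶ 𝒳) (hΦ : Φ ≫ π = π)
    (Φf : ∀ u : ComplexPoints S, fiberOver π u ⟶ fiberOver π u) (hΦf : ∀ u, Φf u ≫ fiberι π u = fiberι π u ≫ Φ)
    {t s : U} (γ : Path.Homotopic.Quotient t s)
    {A B : AbelianVariety ℂ} (eA : A.X ≅ fiberOver π t.1) (eB : B.X ≅ fiberOver π s.1) {φ : A ⟶ A} {ψ : B ⟶ B}
    (heA : eA.hom ≫ Φf t.1 = φ.hom.hom.hom ≫ eA.hom) (heB : eB.hom ≫ Φf s.1 = ψ.hom.hom.hom ≫ eB.hom)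
    (k : ℕ) (χ : ℕ → ℕ → ℂ) (W : complexBetti 𝒳 k)
    (hW : complexBetti.map eA.hom k (complexBetti.map (fiberι π t.1) k W) ∈ pullbackEigenclasses A φ k χ) :
    complexBetti.map eB.hom k (complexBetti.map (fiberι π s.1) k W) ∈ pullbackEigenclasses B ψ k χ := by
  rw [mem_pullbackEigenclasses_iff] at hW ⊢
  intro x y
  -- `φ`-equivariance of the conjugated transport on `H¹`, through the charts
  have hinv : eA.inv ≫ φ.hom.hom.hom = Φf t.1 ≫ eA.inv := by
    rw [Iso.inv_comp_eq, ← Category.assoc, heA, Category.assoc, Iso.hom_inv_id, Category.comp_id]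
  have h1 : ∀ z, complexBetti.map eA.inv 1 (complexBetti.map φ.hom.hom.hom 1 z) =
      complexBetti.map (Φf t.1) 1 (complexBetti.map eA.inv 1 z) := fun z => by
    have hc := congrArg (fun F => complexBetti.map F 1 z) hinv
    simpa only [complexBetti.map_comp, ModuleCat.comp_apply] using hc
  have h2 : ∀ z, complexBetti.map eB.hom 1 (complexBetti.map (Φf s.1) 1 z) =
      complexBetti.map ψ.hom.hom.hom 1 (complexBetti.map eB.hom 1 z) := fun z => by
    have hc := congrArg (fun F => complexBetti.map F 1 z) heB
    simpa only [complexBetti.map_comp, ModuleCat.comp_apply] using hc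
  -- the test pull-backs `(x·𝟙 + y·φ)^*` are intertwined on `H¹`
  have hT1 : ∀ z : complexBetti A.X 1,
      complexBetti.map eB.hom 1 (transportFun π 1 hU γ (complexBetti.map eA.inv 1
        (complexBetti.map (x • 𝟙 A + y • φ).hom.hom.hom 1 z))) =
      complexBetti.map (x • 𝟙 B + y • ψ).hom.hom.hom 1
        (complexBetti.map eB.hom 1 (transportFun π 1 hU γ (complexBetti.map eA.inv 1 z))) := fun z => by
    rw [complexBetti_map_nsmul_id_add_nsmul_one, complexBetti_map_nsmul_id_add_nsmul_one, map_add, map_smul, map_smul,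
      transportFun_add, transportFun_smul, transportFun_smul, map_add, map_smul, map_smul, h1,
      transportFun_map_fiberHom π 1 hU Φ hΦ Φf hΦf γ, h2]
  -- … hence on `H^k`, spanned by the `k`-fold cup products of degree-one classes
  have key : ∀ c : complexBetti A.X k,
      complexBetti.map eB.hom k (transportFun π k hU γ (complexBetti.map eA.inv k
        (complexBetti.map (x • 𝟙 A + y • φ).hom.hom.hom k c))) =
      complexBetti.map (x • 𝟙 B + y • ψ).hom.hom.hom k
        (complexBetti.map eB.hom k (transportFun π k hU γ (complexBetti.map eA.inv k c))) := by
    intro c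
    have hc : c ∈ Submodule.span ℂ (Set.range (cupPowOne ℂ (ComplexPoints A.X) k)) := by
      rw [(Motives.AbelianVariety.hasExteriorCohomologyH1_complexPoints A).span_range_cupPowOne k]
      exact Submodule.mem_top
    -- pull-backs along scheme morphisms are multiplicative on `v₁ ⌣ ⋯ ⌣ v_k`
    have e1 : ∀ {X' Y' : SchemeOver ℂ} (g : X' ⟶ Y') (v : Fin k → complexBetti Y' 1),
        complexBetti.map g k (cupPowOne ℂ (ComplexPoints Y') k v) =
          cupPowOne ℂ (ComplexPoints X') k (fun i => complexBetti.map g 1 (v i)) := fun g v => map_cupPowOne _ k v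
    induction hc using Submodule.span_induction with
    | mem c hc =>
      obtain ⟨w, rfl⟩ := hc
      simp only [e1, transportFun_cupPowOne, hT1]
    | zero => simp only [map_zero, transportFun_zero]
    | add c c' _ _ hc hc' => simp only [map_add, transportFun_add, hc, hc']
    | smul a c _ hc => simp only [map_smul, transportFun_smul, hc]
  -- the transport fixes the restrictions of `W`
  have hT : complexBetti.map eB.hom k (transportFun π k hU γ (complexBetti.map eA.inv k
      (complexBetti.map eA.hom k (complexBetti.map (fiberι π t.1) k W)))) =
      complexBetti.map eB.hom k (complexBetti.map (fiberι π s.1) k W) := by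
    rw [eA.complexBetti_map_inv_map_hom, transportFun_map_fiberι]
  have hWxy := hW x y
  change complexBetti.map (x • 𝟙 A + y • φ).hom.hom.hom k _ = _ at hWxy
  change complexBetti.map (x • 𝟙 B + y • ψ).hom.hom.hom k (complexBetti.map eB.hom k (complexBetti.map (fiberι π s.1) k W)) = _
  rw [← hT, ← key, hWxy, map_smul, transportFun_smul, map_smul]

/-- **The Weil line `E₊` is flat for the `K`-action**: with the data of `mem_pullbackEigenclasses_of_transport`, if `e_A^*(W|X_t) ∈ E₊(A, φ)` then
`e_B^*(W|X_s) ∈ E₊(B, ψ)` (character `(x + iy√d)^{2n}`). [cite: Deligne1982HodgeCycles, §4 proof of Thm. 4.8 (pp. 56–61)] [cite: vanGeemen1994HodgeAV, 4.9] -/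
theorem mem_weilClassesPlus_of_transport (hU : IsCohomologicallyLocallyTrivialOn π U) (Φ : 𝒳 ⟶ 𝒳) (hΦ : Φ ≫ π = π)
    (Φf : ∀ u : ComplexPoints S, fiberOver π u ⟶ fiberOver π u) (hΦf : ∀ u, Φf u ≫ fiberι π u = fiberι π u ≫ Φ)
    {t s : U} (γ : Path.Homotopic.Quotient t s)
    {A B : AbelianVariety ℂ} (eA : A.X ≅ fiberOver π t.1) (eB : B.X ≅ fiberOver π s.1) {φ : A ⟶ A} {ψ : B ⟶ B}
    (heA : eA.hom ≫ Φf t.1 = φ.hom.hom.hom ≫ eA.hom) (heB : eB.hom ≫ Φf s.1 = ψ.hom.hom.hom ≫ eB.hom)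
    {n dK : ℕ} (W : complexBetti 𝒳 (2 * n))
    (hW : complexBetti.map eA.hom (2 * n) (complexBetti.map (fiberι π t.1) (2 * n) W) ∈ weilClassesPlus A φ n dK) :
    complexBetti.map eB.hom (2 * n) (complexBetti.map (fiberι π s.1) (2 * n) W) ∈ weilClassesPlus B ψ n dK :=
  mem_pullbackEigenclasses_of_transport π hU Φ hΦ Φf hΦf γ eA eB heA heB (2 * n) _ W hW

/-- **The Weil line `E₋` is flat for the `K`-action** (character `(x − iy√d)^{2n}`). [cite: Deligne1982HodgeCycles, §4 proof of Thm. 4.8 (pp. 56–61)]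
[cite: vanGeemen1994HodgeAV, 4.9] -/
theorem mem_weilClassesMinus_of_transport (hU : IsCohomologicallyLocallyTrivialOn π U) (Φ : 𝒳 ⟶ 𝒳) (hΦ : Φ ≫ π = π)
    (Φf : ∀ u : ComplexPoints S, fiberOver π u ⟶ fiberOver π u) (hΦf : ∀ u, Φf u ≫ fiberι π u = fiberι π u ≫ Φ)
    {t s : U} (γ : Path.Homotopic.Quotient t s)
    {A B : AbelianVariety ℂ} (eA : A.X ≅ fiberOver π t.1) (eB : B.X ≅ fiberOver π s.1) {φ : A ⟶ A} {ψ : B ⟶ B}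
    (heA : eA.hom ≫ Φf t.1 = φ.hom.hom.hom ≫ eA.hom) (heB : eB.hom ≫ Φf s.1 = ψ.hom.hom.hom ≫ eB.hom)
    {n dK : ℕ} (W : complexBetti 𝒳 (2 * n))
    (hW : complexBetti.map eA.hom (2 * n) (complexBetti.map (fiberι π t.1) (2 * n) W) ∈ weilClassesMinus A φ n dK) :
    complexBetti.map eB.hom (2 * n) (complexBetti.map (fiberι π s.1) (2 * n) W) ∈ weilClassesMinus B ψ n dK :=
  mem_pullbackEigenclasses_of_transport π hU Φ hΦ Φf hΦf γ eA eB heA heB (2 * n) _ W hW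

end Transport

/-! ## §2 Compact abelian pencils: the Weil-line hypotheses of the `B⋆` rows from the charted member alone -/

section Pencil

variable {𝒳 S : SchemeOver ℂ} {f : 𝒳 ⟶ S} {d : ℕ}

/-- **`hUp` FROM THE DATUM AT `t`: on a compact abelian pencil with a global endomorphism `Φ` over `S` and `K`-compatible charts `(A_s, e_s, φ_s)`, a global
class `U ∈ H^{2n}(𝒳(ℂ); ℂ)` with `e_t^*(U|X_t) ∈ E₊(A_t, φ_t)` at ONE member has `e_s^*(U|X_s) ∈ E₊(A_s, φ_s)` at EVERY member** (Ehresmann on complex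
points; path-connectedness of `S(ℂ)`; §1). Part XLVIII-d's `map_chart_fiberι_mem_weilClassesPlus_of_at` asked instead for the `ℤ[φ]`-action `x·𝟙 + y·Φ`
on the pencil. [cite: Deligne1982HodgeCycles, §4 proof of Thm. 4.8 (pp. 56–61)] [cite: VoisinHodgeI2002, Thm. 9.3 and §9.2.1] -/
theorem map_chart_fiberι_mem_weilClassesPlus_member_of_member (hf : IsCompactAbelianPencil f d)
    (Φ : 𝒳 ⟶ 𝒳) (hΦ : Φ ≫ f = f)
    (A : ComplexPoints S → AbelianVariety ℂ) (e : ∀ s, (A s).X ≅ fiberOver f s) (φ : ∀ s, A s ⟶ A s)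
    (hK : ∀ s, ∃ Φs : fiberOver f s ⟶ fiberOver f s, Φs ≫ fiberι f s = fiberι f s ≫ Φ ∧ (e s).hom ≫ Φs = (φ s).hom.hom.hom ≫ (e s).hom)
    {n dK : ℕ} (U₁ : complexBetti 𝒳 (2 * n)) {t : ComplexPoints S}
    (hUt : complexBetti.map (e t).hom (2 * n) (complexBetti.map (fiberι f t) (2 * n) U₁) ∈ weilClassesPlus (A t) (φ t) n dK)
    (s : ComplexPoints S) :
    complexBetti.map (e s).hom (2 * n) (complexBetti.map (fiberι f s) (2 * n) U₁) ∈ weilClassesPlus (A s) (φ s) n dK := by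
  choose Φf hΦf he using hK
  haveI : IsProper S.hom := IsSmoothProjective.isProper_holds hf.isSmoothProjective_base
  haveI : CompactSpace S.left := QuasiCompact.compactSpace_of_compactSpace S.hom
  haveI := hf.isSmoothProjective_base.smoothOfRelativeDimension
  haveI : IsProper f.left := hf.isSmoothProjectiveFamily.isProper
  haveI := hf.isSmoothProjectiveFamily.smoothOfRelativeDimension
  haveI := connectedSpace_complexPoints hf.isSmoothProjective_base
  haveI := pathConnectedSpace_complexPoints_of_smoothOfRelativeDimension S 1
  have hcont : Continuous fun x : ComplexPoints S => (⟨x, Set.mem_univ x⟩ : (Set.univ : Set (ComplexPoints S))) :=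
    continuous_id.subtype_mk _
  exact mem_weilClassesPlus_of_transport f (isCohomologicallyLocallyTrivialOn_univ f d 1) Φ hΦ Φf hΦf
    (t := ⟨t, Set.mem_univ t⟩) (s := ⟨s, Set.mem_univ s⟩) ⟦(PathConnectedSpace.somePath t s).map hcont⟧
    (e t) (e s) (he t) (he s) U₁ hUt

/-- **`hUm` FROM THE DATUM AT `t`**: the same for the Weil line `E₋`. [cite: Deligne1982HodgeCycles, §4 proof of Thm. 4.8 (pp. 56–61)]
[cite: VoisinHodgeI2002, Thm. 9.3 and §9.2.1] -/
theorem map_chart_fiberι_mem_weilClassesMinus_member_of_member (hf : IsCompactAbelianPencil f d)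
    (Φ : 𝒳 ⟶ 𝒳) (hΦ : Φ ≫ f = f)
    (A : ComplexPoints S → AbelianVariety ℂ) (e : ∀ s, (A s).X ≅ fiberOver f s) (φ : ∀ s, A s ⟶ A s)
    (hK : ∀ s, ∃ Φs : fiberOver f s ⟶ fiberOver f s, Φs ≫ fiberι f s = fiberι f s ≫ Φ ∧ (e s).hom ≫ Φs = (φ s).hom.hom.hom ≫ (e s).hom)
    {n dK : ℕ} (U₁ : complexBetti 𝒳 (2 * n)) {t : ComplexPoints S}
    (hUt : complexBetti.map (e t).hom (2 * n) (complexBetti.map (fiberι f t) (2 * n) U₁) ∈ weilClassesMinus (A t) (φ t) n dK)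
    (s : ComplexPoints S) :
    complexBetti.map (e s).hom (2 * n) (complexBetti.map (fiberι f s) (2 * n) U₁) ∈ weilClassesMinus (A s) (φ s) n dK := by
  choose Φf hΦf he using hK
  haveI : IsProper S.hom := IsSmoothProjective.isProper_holds hf.isSmoothProjective_base
  haveI : CompactSpace S.left := QuasiCompact.compactSpace_of_compactSpace S.hom
  haveI := hf.isSmoothProjective_base.smoothOfRelativeDimension
  haveI : IsProper f.left := hf.isSmoothProjectiveFamily.isProper
  haveI := hf.isSmoothProjectiveFamily.smoothOfRelativeDimension
  haveI := connectedSpace_complexPoints hf.isSmoothProjective_base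
  haveI := pathConnectedSpace_complexPoints_of_smoothOfRelativeDimension S 1
  have hcont : Continuous fun x : ComplexPoints S => (⟨x, Set.mem_univ x⟩ : (Set.univ : Set (ComplexPoints S))) :=
    continuous_id.subtype_mk _
  exact mem_weilClassesMinus_of_transport f (isCohomologicallyLocallyTrivialOn_univ f d 1) Φ hΦ Φf hΦf
    (t := ⟨t, Set.mem_univ t⟩) (s := ⟨s, Set.mem_univ s⟩) ⟦(PathConnectedSpace.somePath t s).map hcont⟧
    (e t) (e s) (he t) (he s) U₁ hUt

end Pencil

end Summit.HodgeConjecture.HodgeConjecture.Ring2.AbelianAll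

end
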